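import Literature.Topology.FourManifolds.FlipContext
import Literature.Topology.FourManifolds.HandleSideConstruction
import HarnessLib

/-!
# Existence of a flip context about the top critical point of index `1`

Topic `Literature/Topology/FourManifolds` (fact seat
`provefact-Literature.Topology.FourManifolds.lauden-f709dd520c`, Laudenbach–Poénaru's Lemma 2, the
flip `H₂` of a `1`-handle).  Everything here is **proved**; no named facts.

`FlipContext.lean` packages the two-sided data of the flip of a `1`-handle: a slide context `S`
about the top critical point `p` of a Morse function `f` adapted to the boundary, and a second
handle side on the rotated chart with the same function, point and constants and the same field
on the seed collar.  Here we **construct** one (`exists_flipContext`), exactly as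
`exists_slideContext` (`SlideContextExists.lean`) but with a second call of
`exists_handleSide_data` (`HandleSideConstruction.lean`) on the rotated chart
`rotateChart φ p R₀` (`MorseChartRotate.lean`), with the field of the first side prescribed on
the seed collar `f⁻¹[c - 3τ, c + 5τ]` (which is far below the chart ball).  The outputs record
the function, the point, the chart `φ`, the smallness of the box, the position of the seed level
above `c₀`, and the coordinates and domains of the two handle charts.

## References

* J. Milnor, *Lectures on the h-cobordism theorem* (1965), Def. 3.1, Lemma 3.2, proofs of
  Thms. 3.4 and 3.13. [MilnorHCobordism1965]
* F. Laudenbach, V. Poénaru, Bull. Soc. Math. France 100 (1972), proof of Lemma 2 (pp. 339–340).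
  [LaudenbachPoenaruBSMF1972]
-/

open scoped Manifold ContDiff Topology
open Set Function Module Metric

noncomputable section

namespace Literature.Topology.FourManifolds

open BoundaryManifold MorseChartRotate

universe u

variable {n : ℕ} {M : Type u} [TopologicalSpace M] [T2Space M] [CompactSpace M]
  [ChartedSpace (EuclideanHalfSpace (n + 1)) M] [IsManifold (𝓡∂ (n + 1)) ∞ M]

set_option maxHeartbeats 3200000 in
/-- **Existence of a flip context about the top critical point.**  Data: `n ≥ 2`; `f` Morse
and adapted to the boundary; a critical point `p` with a chart `φ` of the maximal atlas in
Milnor's form of index `1` and a closed chart ball of radius `R₀`; a level `c₀ < f p` above all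
the other critical values with all levels in `(c₀, f p)` connected; an orientation; a bound
`εmax`.  Conclusion: a flip context whose first side has function `f`, point `p`, box size
`≤ εmax`, whose seed level satisfies `c₀ < c - 5τ`, whose chart is `φ` with the radius `R₀`,
and whose two handle charts have the domain `φ.source ∩ φ̂⁻¹ B(φ̂ p, 4ε)` and the coordinates
`φ̂`, resp. `rotAt (φ̂ p) ∘ φ̂`. [cite: MilnorHCobordism1965, Def. 3.1, Lemma 3.2 and proofs of Thms. 3.4, 3.13] -/
theorem exists_flipContext (hn : 2 ≤ n) {f : M → ℝ} (hF : IsMorseAdapted (𝓡∂ (n + 1)) f)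
    {p : M} (hp : IsMCriticalPt (𝓡∂ (n + 1)) f p)
    {φ : OpenPartialHomeomorph M (EuclideanHalfSpace (n + 1))}
    (hφ : φ ∈ IsManifold.maximalAtlas (𝓡∂ (n + 1)) ∞ M) (hpφ : p ∈ φ.source)
    (hfq : ∀ q ∈ φ.source, f q = f p +
      milnorQuadratic 1 (φ.extend (𝓡∂ (n + 1)) q - φ.extend (𝓡∂ (n + 1)) p))
    {R₀ : ℝ} (hR₀ : 0 < R₀) (hR : closedBall (φ.extend (𝓡∂ (n + 1)) p) R₀ ⊆ (φ.extend (𝓡∂ (n + 1))).target)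
    {c₀ : ℝ} (hc₀ : c₀ < f p) (hcrit : ∀ x, IsMCriticalPt (𝓡∂ (n + 1)) f x → x ≠ p → f x < c₀)
    (hconn : ∀ c, c₀ < c → c < f p → IsConnected (f ⁻¹' {c}))
    (oM : SmoothOrientation (𝓡∂ (n + 1)) M) {εmax : ℝ} (hεmax : 0 < εmax) :
    ∃ C : FlipContext n M, C.S.f = f ∧ C.S.p = p ∧ C.φ = φ ∧ C.R₀ = R₀ ∧ C.S.ε ≤ εmax ∧ c₀ < C.c - 5 * C.τ ∧
      (∀ q, C.S.D.chart.extend (𝓡∂ (n + 1)) q = φ.extend (𝓡∂ (n + 1)) q) ∧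
      C.S.D.chart.source = φ.source ∩ φ.extend (𝓡∂ (n + 1)) ⁻¹' ball (φ.extend (𝓡∂ (n + 1)) p) (4 * C.S.ε) ∧
      C.D'.chart.source = φ.source ∩ φ.extend (𝓡∂ (n + 1)) ⁻¹' ball (φ.extend (𝓡∂ (n + 1)) p) (4 * C.S.ε) ∧
      ∀ q ∈ C.D'.chart.source, C.D'.chart.extend (𝓡∂ (n + 1)) q =
        rotAt (le_trans one_le_two hn) (φ.extend (𝓡∂ (n + 1)) p) (φ.extend (𝓡∂ (n + 1)) q) := by
  have hn1 : 1 ≤ n := le_trans one_le_two hn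
  have hfs : ContMDiff (𝓡∂ (n + 1)) 𝓘(ℝ, ℝ) ∞ f := hF.1.contMDiff
  have hp1 : f p < 1 := hF.2.2 p (hF.isInteriorPoint_of_isMCriticalPt hp)
  -- the box size
  set d : ℝ := min ((f p - c₀) / 27) ((1 - f p) / 18) with hd
  have hdpos : 0 < d := lt_min (by linarith) (by linarith)
  set ε : ℝ := min (min εmax (R₀ / 6)) (min (1 / 4 : ℝ) d) with hε
  have hεpos : 0 < ε := lt_min (lt_min hεmax (by linarith)) (lt_min (by norm_num) hdpos)
  have hεmax' : ε ≤ εmax := (min_le_left _ _).trans (min_le_left _ _)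
  have hεR6 : ε ≤ R₀ / 6 := (min_le_left _ _).trans (min_le_right _ _)
  have hεR : 5 * ε ≤ R₀ := by linarith
  have hεR' : 5 * ε < R₀ := by linarith
  have hε4 : ε ≤ 1 / 4 := (min_le_right _ _).trans (min_le_left _ _)
  have hεd : ε ≤ d := (min_le_right _ _).trans (min_le_right _ _)
  have hε2 : ε ^ 2 ≤ d := by nlinarith
  have hd1 : d ≤ (f p - c₀) / 27 := min_le_left _ _
  have hd2 : d ≤ (1 - f p) / 18 := min_le_right _ _
  have hε27 : 27 * ε ^ 2 ≤ f p - c₀ := by linarith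
  have hε18 : 18 * ε ^ 2 ≤ 1 - f p := by linarith
  -- the other constants
  set τ : ℝ := ε ^ 2 / 100 with hτ
  set η : ℝ := τ / 9 with hη
  set c : ℝ := f p - 25 * ε ^ 2 - 8 * τ with hc
  set r : ℝ := ε / 10 with hr
  set γ : ℝ := 32 * r ^ 4 with hγ
  set a : ℝ := f p - ε ^ 2 / 2 with ha
  set ℓu : ℝ := f p + ε ^ 2 with hℓu
  set δ : ℝ := ε ^ 2 / 100 with hδ
  set ℓ₁ : ℝ := c - 4 * τ with hℓ₁
  set ℓ₂ : ℝ := f p + 16 * ε ^ 2 with hℓ₂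
  set ℓ₀ : ℝ := c - 5 * τ with hℓ₀
  set ℓ₃ : ℝ := f p + 17 * ε ^ 2 with hℓ₃
  have hε2pos : 0 < ε ^ 2 := by positivity
  have hτpos : 0 < τ := by positivity
  have hηpos : 0 < η := by positivity
  have hrpos : 0 < r := by positivity
  have hγr : γ = 32 * (ε / 10) ^ 4 := rfl
  have hγε : γ / ε ^ 2 = 32 / 10 ^ 4 * ε ^ 2 := by rw [div_eq_iff hε2pos.ne', hγr]; ring
  have hγε' : γ / (4 * ε ^ 2) = 8 / 10 ^ 4 * ε ^ 2 := by rw [div_eq_iff (by positivity), hγr]; ring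
  have h01 : ℓ₀ < ℓ₁ := by show c - 5 * τ < c - 4 * τ; linarith
  have h23 : ℓ₂ < ℓ₃ := by show f p + 16 * ε ^ 2 < f p + 17 * ε ^ 2; linarith
  have hbd : ∀ x ∈ (𝓡∂ (n + 1)).boundary M, ℓ₃ < f x := fun x hx => by
    rw [(hF.2.1 x hx).1]; show f p + 17 * ε ^ 2 < 1; linarith
  have h8 : 8 * r ^ 2 ≤ 1 := by rw [hr]; nlinarith
  have hrε : 2 * r < ε := by rw [hr]; linarith
  have hℓ₁' : ℓ₁ ≤ f p - 16 * ε ^ 2 := by show c - 4 * τ ≤ f p - 16 * ε ^ 2; linarith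
  have hreg : ∀ x, f x ∈ Icc ℓ₀ ℓ₃ → x ≠ p → mfderiv (𝓡∂ (n + 1)) 𝓘(ℝ, ℝ) f x ≠ 0 := fun x hx hxp hzero => by
    have hxc : IsMCriticalPt (𝓡∂ (n + 1)) f x := hzero
    have := hcrit x hxc hxp
    have : c - 5 * τ ≤ f x := hx.1
    linarith
  have hlow : f p - ε ^ 2 + γ / ε ^ 2 < a - η / 4 := by rw [hγε, ha, hη, hτ]; nlinarith
  have hal : a - η / 4 ≤ f p - 4 * r ^ 2 := by rw [ha, hη, hτ, hr]; nlinarith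
  have hau : f p + 4 * r ^ 2 ≤ ℓu - δ := by rw [hℓu, hδ, hr]; nlinarith
  have hhigh : ℓu < f p + 4 * ε ^ 2 - γ / (4 * ε ^ 2) := by rw [hγε', hℓu]; nlinarith
  -- the data of the first handle side (no prescribed germ)
  obtain ⟨X, θ, D, hXint, hflow, hDk, hDr, hDe, hDs, hball, -, hunit, hspeed, hc1, hc2, hc3, hcore, hcorelt⟩ :=
    exists_handleSide_data (n := n) hfs (ℓ₀ := ℓ₀) (ℓ₁ := ℓ₁) (ℓ₂ := ℓ₂) (ℓ₃ := ℓ₃) h01 h23 hbd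
      hφ hpφ (k := 1) hfq (ε := ε) (r := r) (γ := γ) (η := η) (a := a) (ℓu := ℓu) (δ := δ)
      hεpos hrpos h8 hrε le_rfl hηpos (by positivity)
      ((closedBall_subset_closedBall hεR).trans hR) hℓ₁' le_rfl hreg hlow hal hau hhigh
      (K₂ := ∅) (U₂ := ∅) isClosed_empty isOpen_empty (empty_subset _) (fun x hx => hx.elim)
      (Set.empty_disjoint _) (ξ₂ := fun _ => 0) (fun x hx => hx.elim) (fun x hx => hx.elim)
  -- the rotated chart
  have hφr := rotateChart_mem_maximalAtlas hn1 φ p R₀ hR hφ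
  have hpφr := mem_rotateChart_source hn1 φ p R₀ hR hpφ hR₀
  have hfqr := fun q hq => apply_eq_rotateChart hn1 φ p R₀ hR hpφ hR₀ hfq (q := q) hq
  have hcen : (rotateChart hn1 φ p R₀ hR).extend (𝓡∂ (n + 1)) p = φ.extend (𝓡∂ (n + 1)) p :=
    extend_rotateChart_self hn1 φ p R₀ hR hpφ hR₀
  have hballr : closedBall ((rotateChart hn1 φ p R₀ hR).extend (𝓡∂ (n + 1)) p) (5 * ε) ⊆
      ((rotateChart hn1 φ p R₀ hR).extend (𝓡∂ (n + 1))).target := by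
    rw [hcen]; exact closedBall_subset_rotateChart_target hn1 φ p R₀ hR hεR'
  -- the prescribed germ on the seed collar: the field of the first side
  have hK₂ : IsClosed {x : M | f x ∈ Icc (c - 3 * τ) (c + 5 * τ)} := isClosed_Icc.preimage hfs.continuous
  have hU₂ : IsOpen {x : M | f x ∈ Ioo ℓ₁ (c + 6 * τ)} := isOpen_Ioo.preimage hfs.continuous
  have hKU₂ : {x : M | f x ∈ Icc (c - 3 * τ) (c + 5 * τ)} ⊆ {x : M | f x ∈ Ioo ℓ₁ (c + 6 * τ)} := fun x hx =>
    ⟨by show c - 4 * τ < f x; linarith [hx.1], by linarith [hx.2]⟩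
  have hK₂ℓ : ∀ x ∈ {x : M | f x ∈ Icc (c - 3 * τ) (c + 5 * τ)}, f x ∈ Icc ℓ₁ ℓ₂ := fun x hx =>
    ⟨by show c - 4 * τ ≤ f x; linarith [hx.1], by show f x ≤ f p + 16 * ε ^ 2; linarith [hx.2]⟩
  have hdisj : Disjoint {x : M | f x ∈ Ioo ℓ₁ (c + 6 * τ)}
      ((rotateChart hn1 φ p R₀ hR).source ∩ (rotateChart hn1 φ p R₀ hR).extend (𝓡∂ (n + 1)) ⁻¹'
        ball ((rotateChart hn1 φ p R₀ hR).extend (𝓡∂ (n + 1)) p) (5 * ε)) := by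
    rw [Set.disjoint_left]
    rintro q hq ⟨hqs, hqb⟩
    have hqs₀ : q ∈ φ.source := hqs.1
    have h1 := hfq q hqs₀
    have hnu : ‖φ.extend (𝓡∂ (n + 1)) q - φ.extend (𝓡∂ (n + 1)) p‖ < 5 * ε := by
      rw [mem_preimage, mem_ball, dist_eq_norm, hcen, extend_rotateChart hn1 φ p R₀ hR hqs, norm_rotAt_sub] at hqb
      exact hqb
    have hQ : -(25 * ε ^ 2) ≤ milnorQuadratic 1 (φ.extend (𝓡∂ (n + 1)) q - φ.extend (𝓡∂ (n + 1)) p) := by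
      rw [milnorQuadratic_eq]
      have hA := sqSumLT_le_norm_sq (m := n + 1) 1 (φ.extend (𝓡∂ (n + 1)) q - φ.extend (𝓡∂ (n + 1)) p)
      have hB := sqSumGE_nonneg (m := n + 1) 1 (φ.extend (𝓡∂ (n + 1)) q - φ.extend (𝓡∂ (n + 1)) p)
      have hC : ‖φ.extend (𝓡∂ (n + 1)) q - φ.extend (𝓡∂ (n + 1)) p‖ ^ 2 < (5 * ε) ^ 2 :=
        pow_lt_pow_left₀ hnu (norm_nonneg _) two_ne_zero
      linarith
    have := hq.2
    linarith
  have hξ₂ : ContMDiffOn (𝓡∂ (n + 1)) (𝓡∂ (n + 1)).tangent ∞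
      (fun x => (⟨x, X x⟩ : TangentBundle (𝓡∂ (n + 1)) M)) {x : M | f x ∈ Ioo ℓ₁ (c + 6 * τ)} :=
    hXint.contMDiff.contMDiffOn
  have hξ₂f : ∀ x ∈ {x : M | f x ∈ Ioo ℓ₁ (c + 6 * τ)}, mlineDeriv (𝓡∂ (n + 1)) f x (X x) = 1 := by
    intro x hx
    refine hunit x ⟨hx.1.le, by show f x ≤ f p + 16 * ε ^ 2; linarith [hx.2]⟩ fun hxc => ?_
    have h := D.abs_sub_lt_of_mem_core hxc
    rw [abs_lt, hDr] at h
    have := hx.2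
    nlinarith [h.1]
  -- the data of the second handle side
  obtain ⟨X', θ', D', hXint', hflow', hDk', hDr', hDe', hDs', hball', hXK', hunit', hspeed', hc1', hc2', hc3', hcore', hcorelt'⟩ :=
    exists_handleSide_data (n := n) hfs (ℓ₀ := ℓ₀) (ℓ₁ := ℓ₁) (ℓ₂ := ℓ₂) (ℓ₃ := ℓ₃) h01 h23 hbd
      hφr hpφr (k := 1) hfqr (ε := ε) (r := r) (γ := γ) (η := η) (a := a) (ℓu := ℓu) (δ := δ)
      hεpos hrpos h8 hrε le_rfl hηpos (by positivity) hballr hℓ₁' le_rfl hreg hlow hal hau hhigh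
      hK₂ hU₂ hKU₂ hK₂ℓ hdisj hξ₂ hξ₂f
  -- the first handle side and the slide context
  let S : HandleSide (𝓡∂ (n + 1)) M :=
    { f := f, X := X, θ := θ, p := p, D := D, hf := hfs, hX := hXint.contMDiff, flow := hflow
      ε := ε, γ := γ, η := η, a := a, ℓ₁ := ℓ₁, ℓ₂ := ℓ₂, ℓu := ℓu, δ := δ
      ε_pos := hεpos, γ_pos := by positivity, η_pos := hηpos, δ_pos := by positivity
      hball := hball, hunit := hunit, hspeed := hspeed
      isClosed_region := hc1, isClosed_region_half := hc2, isClosed_region_small := hc3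
      core_subset := hcore, lt_of_mem_core := hcorelt
      hlow := hlow, hhigh := hhigh
      hℓ₁ := by show c - 4 * τ < a - (ℓu - a) - η; rw [hc, ha, hℓu, hη, hτ]; nlinarith
      ha := by show a + η < ℓu - δ; rw [ha, hℓu, hδ, hη, hτ]; nlinarith
      hℓu := by show f p + ε ^ 2 < f p + 16 * ε ^ 2; nlinarith }
  let C₁ : SlideContext n M :=
    { S := S, hn := hn, hF := hF, c := c, τ := τ, τ_pos := hτpos, hk := hDk
      hr_eq := by show D.r = ε / 10; rw [hDr]
      hγ_eq := by show γ = 32 * D.r ^ 4; rw [hDr]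
      ha_eq := rfl, hℓu_eq := rfl, hδ_eq := rfl, hℓ₁_eq := rfl, hℓ₂_eq := rfl, hε1 := hε4, hτε := le_rfl
      hηε := by show η ≤ ε ^ 2 / 100; rw [hη, hτ]; nlinarith
      hητ := by show 9 * η ≤ τ; rw [hη]; linarith
      hcτ := by show c + 8 * τ ≤ f p - 25 * ε ^ 2; rw [hc]; linarith
      htop := by show f p + 17 * ε ^ 2 < 1; linarith
      hreg := fun x hx hxp hxc => by
        have := hcrit x hxc hxp
        have hx' : c - 5 * τ ≤ f x := hx
        linarith
      hconn := hconn c (by rw [hc, hτ]; nlinarith) (by rw [hc]; linarith)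
      oM := oM }
  -- the flip context
  refine ⟨{ C₁ with
      φ := φ, R₀ := R₀, hεR := hεR, hballR := hR, hpφ := hpφ, hDe := hDe, hDs := by rw [hDs]; exact inter_subset_left
      X' := X', θ' := θ', D' := D', hX' := hXint'.contMDiff, flow' := hflow', hk' := hDk'
      hr' := by show D'.r = D.r; rw [hDr', hDr]
      hDe' := hDe'
      hDs' := by rw [hDs']; exact inter_subset_left
      hball' := hball', hunit' := hunit', hspeed' := hspeed'
      isClosed_region' := hc1', isClosed_region_half' := hc2', isClosed_region_small' := hc3'
      core_subset' := hcore', lt_of_mem_core' := hcorelt'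
      hrel := fun x hx => hXK' x hx }, rfl, rfl, rfl, rfl, hεmax', ?_, hDe, hDs, ?_, ?_⟩
  · show c₀ < c - 5 * τ
    rw [hc, hτ]; nlinarith
  · -- the domain of the second chart: the rotation preserves the chart balls about `φ̂ p`
    show D'.chart.source = φ.source ∩ φ.extend (𝓡∂ (n + 1)) ⁻¹' ball (φ.extend (𝓡∂ (n + 1)) p) (4 * ε)
    rw [hDs', hcen]
    ext q
    simp only [mem_inter_iff, mem_preimage, rotateChart_source]
    constructor
    · rintro ⟨⟨hqs, hqR⟩, hqb⟩
      refine ⟨hqs, ?_⟩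
      rw [mem_ball, dist_eq_norm, extend_rotateChart hn1 φ p R₀ hR ⟨hqs, hqR⟩, norm_rotAt_sub] at hqb
      rw [mem_ball, dist_eq_norm]; exact hqb
    · rintro ⟨hqs, hqb⟩
      have hqR : φ.extend (𝓡∂ (n + 1)) q ∈ ball (φ.extend (𝓡∂ (n + 1)) p) R₀ := by
        rw [mem_ball, dist_eq_norm] at hqb ⊢; linarith
      refine ⟨⟨hqs, hqR⟩, ?_⟩
      rw [mem_ball, dist_eq_norm, extend_rotateChart hn1 φ p R₀ hR ⟨hqs, hqR⟩, norm_rotAt_sub]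
      rw [mem_ball, dist_eq_norm] at hqb; exact hqb
  · -- the coordinates of the second chart
    intro q hq
    show D'.chart.extend (𝓡∂ (n + 1)) q = _
    rw [hDe']
    have hq' : q ∈ (rotateChart hn1 φ p R₀ hR).source := by rw [hDs'] at hq; exact hq.1
    exact extend_rotateChart hn1 φ p R₀ hR hq'

end Literature.Topology.FourManifolds
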